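import Summits.AnomalousDissipation.AnomalousDissipation.Theses.MomentParity
import Summits.AnomalousDissipation.AnomalousDissipation.Theorems.QuarticGate.Negative.EnergyRow
import Summits.AnomalousDissipation.AnomalousDissipation.Theorems.CubicParityLoud.Negative.EnergyRow
import Summits.AnomalousDissipation.AnomalousDissipation.Theorems.ResolvedDissipation.Negative.KillShape
import Literature.Analysis.FluidPDE.StatisticalSolutionEnergyEq
import Literature.Analysis.FluidPDE.StatisticalSolutionProofs

/-!
# Route MomentParity · crux `ResolvedDissipation` (stmt-AnomalousDissipation-14284) —
# line `lions-l4-domination`, stub K2c `stub_scheduleOfLimitEnergyEq`: the leak contradiction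

Supports stmt-AnomalousDissipation-14284 (no route-item statement is asserted).

Fix `ν > 0`, `f ∈ L²(T³; ℝ³)` and a radius `R`. Call a law `μ` on `H = L²_σ(T³)` ADMISSIBLE at
level `N` if it is a probability measure carried by level-`N` Fourier–Galerkin fields
(`IsLevel N` a.e.), supported in the ball `‖u‖ ≤ R`, and stationary at every order for Galerkin NS at
`(ν, f)` (`∀ d, IsPolyStationary ν f N d μ`). The main theorem `stub_scheduleOfLimitEnergyEq` is the
KILL-SHAPE CONTRADICTION of the crux (Disproof §5, `not_resolvedDissipation_iff_killShape`): IF every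
sequence of admissible laws `μ_i` at levels `N_i → ∞` admits a subsequence `φ` and a "limit" `μ_∞` with
finite mean enstrophy, the mean energy EQUALITY `ν ∫‖∇u‖² dμ_∞ = ∫ (u, f) dμ_∞`, convergence of the
injections `∫ (u, f) dμ_{φ i} → ∫ (u, f) dμ_∞` and of every truncated mean enstrophy
`∫ ‖∇P_K u‖² dμ_{φ i} → ∫ ‖∇P_K u‖² dμ_∞`, THEN one cutoff schedule `κ : ℕ → ℕ` resolves the mean
enstrophy of every admissible law at every level:
`∫ ‖∇u‖² dμ ≤ ∫ ‖∇P_{κ n} u‖² dμ + 1/(n+1)`.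

Proof (pure real analysis + the level-`N` energy row). Otherwise some tolerance `δ = 1/(n+1)` and,
for every cutoff `K`, an admissible `μ_K` at level `N_K` with `∫‖∇P_K u‖² dμ_K + δ < ∫‖∇u‖² dμ_K`;
necessarily `N_K > K` (`isResolved_const_of_level_le`), so `N_K → ∞` and the hypothesis applies. By the
energy row at each level (`ensembleDissipation_eq_of_polyStationary`) the mean enstrophies
`E_i = ∫ (u,f) dμ_{φ i} / ν` converge to `∫ (u,f) dμ_∞ / ν = E_∞`, the mean enstrophy of the limit.
For fixed `K` and `φ i ≥ K`, monotonicity of `K ↦ ‖∇P_K u‖²` gives `∫‖∇P_K u‖² dμ_{φ i} + δ ≤ E_{φ i}`;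
letting `i → ∞`, `∫‖∇P_K u‖² dμ_∞ + δ ≤ E_∞`; letting `K → ∞` (monotone convergence,
`‖∇P_K u‖² ↑ ‖∇u‖²` pointwise), `E_∞ + δ ≤ E_∞ < ∞` — absurd.

Helpers (all folklore): measurability of `u ↦ ‖∇P_K u‖²` on `H`, the pointwise limit
`‖∇P_K v‖² → ‖∇v‖²` in `ℝ≥0∞` (no finiteness needed), the resulting monotone convergence of the mean
truncated enstrophies, and the energy-row formula `∫⁻ ‖∇u‖² dμ = ofReal (∫ (u,f) dμ / ν)` for admissible
laws.
-/

noncomputable section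

-- `Summit.<Summit>.<Problem>`: single-conjunct summit, the duplicate namespace segment is mandated.
set_option linter.dupNamespace false

namespace Summit.AnomalousDissipation.AnomalousDissipation.Theorems.MomentParityResolvedDissipation.Schedule

open MeasureTheory Filter Topology
open scoped ENNReal NNReal InnerProductSpace RealInnerProductSpace
open Literature.Analysis.FunctionSpaces Literature.Analysis.FluidPDE
open Summit.AnomalousDissipation.AnomalousDissipation.Theses.MomentParity
open Summit.AnomalousDissipation.AnomalousDissipation.Theorems.QuarticGate.Negative

/-! ## Helpers: truncated enstrophy on `H` — measurability and monotone convergence -/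

/-- The truncated enstrophy `u ↦ ‖∇P_K u‖²` is Borel measurable on `H` (a finite sum of continuous
functions of finitely many Fourier coefficients). [folklore] -/
theorem measurable_eGradNormSq_fourierTruncate (K : ℕ) :
    Measurable fun u : Torus.energySpace (Fin 3) =>
      Torus.eGradNormSq (Torus.fourierTruncate K
        (u.1 : UnitAddTorus (Fin 3) → EuclideanSpace ℝ (Fin 3))) := by
  have h : (fun u : Torus.energySpace (Fin 3) =>
      Torus.eGradNormSq (Torus.fourierTruncate K
        (u.1 : UnitAddTorus (Fin 3) → EuclideanSpace ℝ (Fin 3)))) =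
      fun u : Torus.energySpace (Fin 3) => ENNReal.ofReal (4 * Real.pi ^ 2) *
        ∑ k ∈ Torus.freqBall K, ENNReal.ofReal (Torus.freqNormSq k) *
          ‖UnitAddTorus.mFourierCoeff (EuclideanSpace.complexify ∘
            (u.1 : UnitAddTorus (Fin 3) → EuclideanSpace ℝ (Fin 3))) k‖ₑ ^ 2 :=
    funext fun u => Torus.eGradNormSq_fourierTruncate_eq_sum ((Lp.memLp u.1).integrable one_le_two) K
  rw [h]
  refine Measurable.const_mul (Finset.measurable_sum _ fun k _ => Measurable.const_mul ?_ _) _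
  exact ((Torus.continuous_mFourierCoeff_complexify_coe k).comp
    continuous_subtype_val).measurable.enorm.pow_const 2

/-- The enstrophy of the truncations converges in `ℝ≥0∞`: `‖∇P_K v‖² → ‖∇v‖²` as `K → ∞`, for every
integrable `v` (finite or infinite enstrophy: partial sums of the spectral series over the exhausting
balls `freqBall K`). [folklore] -/
theorem tendsto_eGradNormSq_fourierTruncate {v : UnitAddTorus (Fin 3) → EuclideanSpace ℝ (Fin 3)}
    (hv : Integrable v volume) :
    Tendsto (fun K => Torus.eGradNormSq (Torus.fourierTruncate K v)) atTop
      (𝓝 (Torus.eGradNormSq v)) := by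
  have hsum : HasSum (fun k : Fin 3 → ℤ => ENNReal.ofReal (Torus.freqNormSq k) *
      ‖UnitAddTorus.mFourierCoeff (EuclideanSpace.complexify ∘ v) k‖ₑ ^ 2)
      (∑' k : Fin 3 → ℤ, ENNReal.ofReal (Torus.freqNormSq k) *
        ‖UnitAddTorus.mFourierCoeff (EuclideanSpace.complexify ∘ v) k‖ₑ ^ 2) :=
    ENNReal.summable.hasSum
  have h1 := ENNReal.Tendsto.const_mul (a := ENNReal.ofReal (4 * Real.pi ^ 2))
    (hsum.comp Torus.tendsto_freqBall_atTop) (Or.inr ENNReal.ofReal_ne_top)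
  rw [← Torus.eGradNormSq_eq_tsum] at h1
  refine h1.congr fun K => ?_
  simp only [Function.comp_apply]
  rw [← Torus.eGradNormSq_fourierTruncate_eq_sum hv]

/-- **Monotone convergence of the mean truncated enstrophy**: for every measure `μ` on `H`,
`∫⁻ ‖∇P_K u‖² dμ → ∫⁻ ‖∇u‖² dμ` as `K → ∞` (`‖∇P_K u‖² ↑ ‖∇u‖²` pointwise). [folklore] -/
theorem tendsto_lintegral_eGradNormSq_fourierTruncate (μ : Measure (Torus.energySpace (Fin 3))) :
    Tendsto (fun K => ∫⁻ u, Torus.eGradNormSq (Torus.fourierTruncate K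
        (u.1 : UnitAddTorus (Fin 3) → EuclideanSpace ℝ (Fin 3))) ∂μ) atTop
      (𝓝 (∫⁻ u, Torus.eGradNormSq (u.1 : UnitAddTorus (Fin 3) → EuclideanSpace ℝ (Fin 3)) ∂μ)) :=
  lintegral_tendsto_of_tendsto_of_monotone
    (fun K => (measurable_eGradNormSq_fourierTruncate K).aemeasurable)
    (ae_of_all _ fun u => fun _ _ hKK' =>
      Theorems.ResolvedDissipation.Negative.eGradNormSq_fourierTruncate_mono hKK'
        ((Lp.memLp u.1).integrable one_le_two))
    (ae_of_all _ fun u => tendsto_eGradNormSq_fourierTruncate ((Lp.memLp u.1).integrable one_le_two))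

/-! ## Helper: the energy row of an admissible law -/

/-- **Energy row of an admissible law** (`3`-stationarity suffices): for a level-`N` probability law in
the ball `‖u‖ ≤ R`, stationary at all orders for Galerkin NS at `(ν, f)` with `ν > 0`, `f ∈ L²`, the mean
enstrophy is finite and equals `∫ (u, f) dμ / ν` (as `ENNReal.ofReal`). [folklore] -/
theorem ensembleEnstrophy_eq_ofReal {ν : ℝ} (hν : 0 < ν)
    {f : UnitAddTorus (Fin 3) → EuclideanSpace ℝ (Fin 3)} (hf : MemLp f 2 volume) {N : ℕ}
    {μ : Measure (Torus.energySpace (Fin 3))} [IsProbabilityMeasure μ]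
    (hlev : ∀ᵐ u ∂μ, IsLevel N u) {R : ℝ} (hR : ∀ᵐ u ∂μ, ‖u‖ ≤ R)
    (hstat : ∀ d : ℕ, IsPolyStationary ν f N d μ) :
    Torus.ensembleEnstrophy μ = ENNReal.ofReal ((∫ u, Torus.pairing u.1 f ∂μ) / ν) := by
  have h2 : Integrable (fun u : Torus.energySpace (Fin 3) => ‖u‖ ^ 2) μ :=
    Integrable.of_bound (continuous_norm.pow 2).aestronglyMeasurable (R ^ 2) (hR.mono fun u hu => by
      rw [Real.norm_eq_abs, abs_of_nonneg (by positivity)]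
      exact pow_le_pow_left₀ (norm_nonneg _) hu 2)
  have hrow := ensembleDissipation_eq_of_polyStationary f hf hlev h2 le_rfl (hstat 3)
  unfold Torus.ensembleDissipation at hrow
  rw [← ENNReal.ofReal_toReal (Theorems.ResolvedDissipation.Negative.ensembleEnstrophy_ne_top hlev hR)]
  congr 1
  rw [eq_div_iff hν.ne', mul_comm]
  exact hrow

/-! ## The leak contradiction -/

/-- **K2c `stub_scheduleOfLimitEnergyEq`** (line `lions-l4-domination` of crux `ResolvedDissipation`,
stmt-AnomalousDissipation-14284). Fix `ν > 0`, `f ∈ L²`, `R`. Suppose every sequence of admissible laws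
`μ_i` (probability, level-`N_i` carried, in the ball `‖u‖ ≤ R`, stationary at all orders for Galerkin NS
at `(ν, f)`) at levels `N_i → ∞` admits a subsequence `φ` and a law `μ_∞` with FINITE mean enstrophy,
the mean energy EQUALITY `ν ∫‖∇u‖² dμ_∞ = ∫ (u, f) dμ_∞`, `∫ (u, f) dμ_{φ i} → ∫ (u, f) dμ_∞`, and
`∫ ‖∇P_K u‖² dμ_{φ i} → ∫ ‖∇P_K u‖² dμ_∞` for every `K`. Then ONE schedule `κ` resolves every
admissible law at every level: `∫ ‖∇u‖² dμ ≤ ∫ ‖∇P_{κ n} u‖² dμ + 1/(n+1)` for all `n`.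
Proof by contradiction through the kill shape (Disproof §5): a leaking family at tolerance `1/(n+1)`
lives at levels `N_K > K → ∞`; along the subsequence the energy rows give `E_{φ i} → E_∞`, the leak
gives `∫‖∇P_K u‖² dμ_∞ + 1/(n+1) ≤ E_∞` for every `K`, and monotone convergence in `K` gives
`E_∞ + 1/(n+1) ≤ E_∞ < ∞`. [folklore] -/
theorem stub_scheduleOfLimitEnergyEq :
    ∀ (ν : ℝ) (f : UnitAddTorus (Fin 3) → EuclideanSpace ℝ (Fin 3)) (R : ℝ), 0 < ν → MemLp f 2 volume →
    (∀ (Nl : ℕ → ℕ) (μ : ℕ → Measure (Torus.energySpace (Fin 3))),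
      (∀ i, IsProbabilityMeasure (μ i)) → (∀ i, ∀ᵐ u ∂(μ i), IsLevel (Nl i) u) →
      (∀ i, ∀ᵐ u ∂(μ i), ‖u‖ ≤ R) → (∀ i (d : ℕ), IsPolyStationary ν f (Nl i) d (μ i)) →
      Tendsto Nl atTop atTop →
      ∃ φ : ℕ → ℕ, StrictMono φ ∧ ∃ μlim : Measure (Torus.energySpace (Fin 3)),
        Torus.ensembleEnstrophy μlim ≠ ⊤ ∧
        ν * (Torus.ensembleEnstrophy μlim).toReal = ∫ u, Torus.pairing u.1 f ∂μlim ∧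
        Tendsto (fun i => ∫ u, Torus.pairing u.1 f ∂(μ (φ i))) atTop
          (𝓝 (∫ u, Torus.pairing u.1 f ∂μlim)) ∧
        (∀ K : ℕ, Tendsto (fun i => ∫⁻ u, Torus.eGradNormSq (Torus.fourierTruncate K
            (u.1 : UnitAddTorus (Fin 3) → EuclideanSpace ℝ (Fin 3))) ∂(μ (φ i))) atTop
          (𝓝 (∫⁻ u, Torus.eGradNormSq (Torus.fourierTruncate K
            (u.1 : UnitAddTorus (Fin 3) → EuclideanSpace ℝ (Fin 3))) ∂μlim)))) →
    ∃ κ : ℕ → ℕ, ∀ (N : ℕ) (μ : Measure (Torus.energySpace (Fin 3))), IsProbabilityMeasure μ →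
      (∀ᵐ u ∂μ, IsLevel N u) → (∀ᵐ u ∂μ, ‖u‖ ≤ R) → (∀ d : ℕ, IsPolyStationary ν f N d μ) →
      ∀ n : ℕ, ∫⁻ u, Torus.eGradNormSq (u.1 : UnitAddTorus (Fin 3) → EuclideanSpace ℝ (Fin 3)) ∂μ ≤
        (∫⁻ u, Torus.eGradNormSq (Torus.fourierTruncate (κ n)
          (u.1 : UnitAddTorus (Fin 3) → EuclideanSpace ℝ (Fin 3))) ∂μ) + ((n : ℝ≥0∞) + 1)⁻¹ := by
  intro ν f R hν hf hyp
  by_contra hcon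
  -- Step 1 (kill shape, pure logic): one tolerance `1/(n+1)` unresolved at EVERY cutoff `K`
  obtain ⟨n, hn⟩ : ∃ n : ℕ, ∀ K : ℕ, ∃ (N : ℕ) (μ : Measure (Torus.energySpace (Fin 3))),
      IsProbabilityMeasure μ ∧ (∀ᵐ u ∂μ, IsLevel N u) ∧ (∀ᵐ u ∂μ, ‖u‖ ≤ R) ∧
      (∀ d : ℕ, IsPolyStationary ν f N d μ) ∧
      ¬ (∫⁻ u, Torus.eGradNormSq (u.1 : UnitAddTorus (Fin 3) → EuclideanSpace ℝ (Fin 3)) ∂μ ≤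
        (∫⁻ u, Torus.eGradNormSq (Torus.fourierTruncate K
          (u.1 : UnitAddTorus (Fin 3) → EuclideanSpace ℝ (Fin 3))) ∂μ) + ((n : ℝ≥0∞) + 1)⁻¹) := by
    by_contra h
    push Not at h
    choose Kf hK using h
    exact hcon ⟨Kf, fun N μ hp hl hb hs n => hK n N μ hp hl hb hs⟩
  choose Nl μ hp hl hb hs hunres using hn
  -- Step 2: the leaking levels escape to infinity (`N_K ≤ K` would be exactly resolved at cutoff `K`)
  have hlt : ∀ K, K < Nl K := fun K => by
    by_contra hK
    push Not at hK
    exact hunres K (Theorems.ResolvedDissipation.Negative.isResolved_const_of_level_le hK (hl K) n)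
  have hNl : Tendsto Nl atTop atTop := tendsto_atTop_mono (fun K => (hlt K).le) tendsto_id
  -- Step 3: the hypothesis along the leaking sequence
  obtain ⟨φ, hφ, μlim, hfin, heq, hP, hT⟩ := hyp Nl μ hp hl hb hs hNl
  -- Step 4: energy rows — the mean enstrophies converge to the (finite) mean enstrophy of the limit
  have hElim : Torus.ensembleEnstrophy μlim = ENNReal.ofReal ((∫ u, Torus.pairing u.1 f ∂μlim) / ν) := by
    rw [← ENNReal.ofReal_toReal hfin]
    congr 1
    rw [eq_div_iff hν.ne', mul_comm]
    exact heq
  have hE : Tendsto (fun i => Torus.ensembleEnstrophy (μ (φ i))) atTop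
      (𝓝 (Torus.ensembleEnstrophy μlim)) := by
    have h' : (fun i => Torus.ensembleEnstrophy (μ (φ i))) =
        fun i => ENNReal.ofReal ((∫ u, Torus.pairing u.1 f ∂(μ (φ i))) / ν) :=
      funext fun i => by
        haveI := hp (φ i)
        exact ensembleEnstrophy_eq_ofReal hν hf (hl (φ i)) (hb (φ i)) (hs (φ i))
    rw [h', hElim]
    exact ENNReal.tendsto_ofReal (hP.div_const ν)
  -- Step 5: for every cutoff `K`, `∫⁻ ‖∇P_K u‖² dμ_∞ + δ ≤ E_∞` (limit `i → ∞` of the leak at `φ i ≥ K`)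
  have hK : ∀ K : ℕ, (∫⁻ u, Torus.eGradNormSq (Torus.fourierTruncate K
      (u.1 : UnitAddTorus (Fin 3) → EuclideanSpace ℝ (Fin 3))) ∂μlim) + ((n : ℝ≥0∞) + 1)⁻¹ ≤
      Torus.ensembleEnstrophy μlim := by
    intro K
    refine le_of_tendsto_of_tendsto ((hT K).add tendsto_const_nhds) hE ?_
    filter_upwards [eventually_ge_atTop K] with i hi
    have hKi : K ≤ φ i := hi.trans (hφ.id_le i)
    calc (∫⁻ u, Torus.eGradNormSq (Torus.fourierTruncate K
            (u.1 : UnitAddTorus (Fin 3) → EuclideanSpace ℝ (Fin 3))) ∂(μ (φ i))) + ((n : ℝ≥0∞) + 1)⁻¹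
        ≤ (∫⁻ u, Torus.eGradNormSq (Torus.fourierTruncate (φ i)
            (u.1 : UnitAddTorus (Fin 3) → EuclideanSpace ℝ (Fin 3))) ∂(μ (φ i))) + ((n : ℝ≥0∞) + 1)⁻¹ :=
          add_le_add (lintegral_mono fun u : Torus.energySpace (Fin 3) =>
            Theorems.ResolvedDissipation.Negative.eGradNormSq_fourierTruncate_mono hKi
              ((Lp.memLp u.1).integrable one_le_two)) le_rfl
      _ ≤ ∫⁻ u, Torus.eGradNormSq (u.1 : UnitAddTorus (Fin 3) → EuclideanSpace ℝ (Fin 3)) ∂(μ (φ i)) :=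
          (not_le.1 (hunres (φ i))).le
      _ = Torus.ensembleEnstrophy (μ (φ i)) := rfl
  -- Step 6: `K → ∞` by monotone convergence: `E_∞ + δ ≤ E_∞ < ∞`, absurd
  have hle : Torus.ensembleEnstrophy μlim + ((n : ℝ≥0∞) + 1)⁻¹ ≤ Torus.ensembleEnstrophy μlim :=
    le_of_tendsto' ((tendsto_lintegral_eGradNormSq_fourierTruncate μlim).add tendsto_const_nhds) hK
  have hδ : ((n : ℝ≥0∞) + 1)⁻¹ ≠ 0 := ENNReal.inv_ne_zero.2 (by simp)
  exact absurd hle (not_le.2 (ENNReal.lt_add_right hfin hδ))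

end Summit.AnomalousDissipation.AnomalousDissipation.Theorems.MomentParityResolvedDissipation.Schedule

end
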